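import Summits.BirchSwinnertonDyer.BirchSwinnertonDyer.Theorems.GenusKolyvaginAtTwoShaCardDvdPowAtTwoRTLevelDescent
import HarnessLib

/-!
# Route `GenusKolyvaginAtTwo`, crux U_T `ShaCardDvdPowAtTwoRT` (stmt-BirchSwinnertonDyer-23658; upper half
# `#Ш(E/K)[2^∞] ∣ 2^(2M₀)`) — TQ-DEEP IN DISPLAYED FORM: the ℚ-descent of a class whose `K`-restriction DOUBLES one level up is Selmer over
# `ℚ`, both members (`E` and the twin `E^{(c)}`); naturality of restriction and of the twist identification with the change of level

Seat `bsd-line-gk2-p3` g25 (PROVER seat 3/3, cell `bsd-f1-sign2`), `--supports stmt-BirchSwinnertonDyer-23658` (helper; closes nothing).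
THEOREMS ONLY (no definition, no named fact, no `sorry`); plumbing over `…ShaCardDvdPowAtTwoRTLevelDescent` (p743025).  BSD is NOT proved by
any of this; neither is U_T nor any stub.

WHY (seat memo `Cruxes/ShaCardDvdPowAtTwoRT/Lines/norm-sharp-upper-gk2p3.md` §8).  For the LINE's Kolyvagin classes with margin one the tree
has: the ℚ-descents `u_M`, `u_{M+1}` of `c_M(n)`, `c_{M+1}(n)` (this lineage's `…EigenClassesFinite`, both signs), McCallum's Lemma 4.6
`ι_* c_M(n) = 2 • c_{M+1}(n)` over `K` (`torsionH1OfDvd_kolyvaginClass_pow`), injectivity of `res` (`resTorsion_injective_of_noTorsion`),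
and Gross 6.2 (`c_{M+1}(n)` Selmer off `n`, `kolyvaginClass_two_mem_selmerLocalKer_of_odd_tamagawaProduct`).  This file turns exactly these
displayed inputs into «`u_M` is Selmer at `v`» for EVERY finite place `v` of `ℚ` off `n` — in particular at the TRANSPOSITION primes `q ∣ d_K`,
where the one-bit descent alone fails: the transposition-prime nuisance of the ℚ-frame certificate for the bottom layer of `Ш(E/K)` vanishes.
* §1 `resTorsion_torsionH1OfDvd` (`res ∘ ι_* = ι_* ∘ res`), `hPsiKT_torsionH1OfDvd` (`hPsiKT ∘ ι_* = ι_* ∘ hPsiKT`) — maps of compatible pairs.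
* §2 **`mem_selmerLocalKer_of_resTorsion_level`** / `mem_selmerGroup_of_resTorsion_level` (member `E`) and
  **`mem_selmerLocalKer_twin_of_resTorsion_level`** / `mem_selmerGroup_twin_of_resTorsion_level` (twin member `E^{(c)}`).

References: [McCallumLMS1991] §4 Lemma 4.3, Lemma 4.6; [Kolyvagin1989Izv] §3; [GrossLMS1991] Prop. 6.2; [SerreGaloisCohomology1997] I §2.4;
[SilvermanAEC2009] X.5 Cor. 5.4.
-/

set_option autoImplicit false
set_option linter.dupNamespace false -- tree convention: `Summit.BirchSwinnertonDyer.BirchSwinnertonDyer.Theorems` (summit = sub-problem)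

noncomputable section

open scoped Classical

universe u

namespace Summit.BirchSwinnertonDyer.BirchSwinnertonDyer.Theorems.GenusExact.SelmerDescent

open WeierstrassCurve NumberField IsDedekindDomain Field
open Literature.NumberTheory.EllipticCurves Literature.NumberTheory.GaloisRepresentations
open Summit.BirchSwinnertonDyer.BirchSwinnertonDyer.Theorems.GenusExact.ArchVanishing
open Summit.BirchSwinnertonDyer.BirchSwinnertonDyer.Theorems.GenusExact.VisiblePairAtTwo

/-! ## §1 Naturality: restriction and the twist identification commute with the change of level -/

section Naturality

variable {F : Type u} [Field F] (W : WeierstrassCurve F) (L : Type u) [Field L] [Algebra F L]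

/-- **`res ∘ ι_* = ι_* ∘ res`**: restriction `H¹(F, E[·]) → H¹(L, E_L[·])` commutes with the change of level `ι_* : H¹(·, E[d]) → H¹(·, E[n])`
(`d ∣ n`) — both composites are the map of the compatible pair `(resGal L, E[d](F̄) → E_L[n](L̄))`. [cite: SerreGaloisCohomology1997, I §2.4] -/
theorem resTorsion_torsionH1OfDvd {d n : ℤ} (h : d ∣ n) (x : galH1Torsion W d) :
    resTorsion W L n (torsionH1OfDvd W h x) = torsionH1OfDvd (W.baseChange L) h (resTorsion W L d x) := by
  have e : (resTorsion W L n).comp (torsionH1OfDvd W h) = (torsionH1OfDvd (W.baseChange L) h).comp (resTorsion W L d) := by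
    unfold resTorsion torsionH1OfDvd
    rw [resH1Hom_comp, resH1Hom_comp]
    exact resH1Hom_congr (by ext; rfl) (AddMonoidHom.ext fun P ↦ Subtype.ext rfl) _ _
  exact DFunLike.congr_fun e x

end Naturality

section TwistNaturality

variable {K : Type} [Field K] [NumberField K] (W : WeierstrassCurve ℚ) {θ : K} {c : ℚ}
  (hθ : θ ∉ Set.range (algebraMap ℚ K)) (hc : θ ^ 2 = algebraMap ℚ K c)

/-- **`hPsiKT ∘ ι_* = ι_* ∘ hPsiKT`**: the twist identification `H¹(K, E^{(c)}_K[·]) ≅ H¹(K, E_K[·])` (`K = ℚ(θ)`, `θ² = c`) commutes with the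
change of level (both are maps of compatible pairs over `id_{Γ_K}`; on points both are `twistIso`). [cite: SilvermanAEC2009, X.5 Cor. 5.4]
[cite: SerreGaloisCohomology1997, I §2.4] -/
theorem hPsiKT_torsionH1OfDvd {d n : ℤ} (h : d ∣ n) (s : galH1Torsion ((W.quadraticTwist c).baseChange K) d) :
    hPsiKT W K hθ hc n (torsionH1OfDvd ((W.quadraticTwist c).baseChange K) h s) =
      torsionH1OfDvd (W.baseChange K) h (hPsiKT W K hθ hc d s) := by
  rw [hPsiKT_apply, hPsiKT_apply]
  have e : (resH1Hom (ContinuousMonoidHom.id _) (psiKT W K hθ hc n).toAddMonoidHom (psiKT_smul W K hθ hc n)).comp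
        (torsionH1OfDvd ((W.quadraticTwist c).baseChange K) h) =
      (torsionH1OfDvd (W.baseChange K) h).comp
        (resH1Hom (ContinuousMonoidHom.id _) (psiKT W K hθ hc d).toAddMonoidHom (psiKT_smul W K hθ hc d)) := by
    unfold torsionH1OfDvd
    rw [resH1Hom_comp, resH1Hom_comp]
    exact resH1Hom_congr (by ext; rfl) (AddMonoidHom.ext fun P ↦ Subtype.ext rfl) _ _
  exact DFunLike.congr_fun e s

end TwistNaturality

/-! ## §2 The ℚ-descent of a class whose `K`-restriction doubles one level up is Selmer — both members -/

section Rat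

variable {K : Type} [Field K] [NumberField K] (W : WeierstrassCurve ℚ)

/-- **TQ-DEEP, member `E` (displayed form).**  `K/ℚ` quadratic, `d ∣ n`, `res : H¹(ℚ, E[n]) → H¹(K, E_K[n])` injective (`E(K)[n] = 0`:
`EigenClassesFinite.resTorsion_injective_of_noTorsion`).  If `res u_d = c_d`, `res u_n = c_n`, `ι_* c_d = 2 • c_n` over `K` (McCallum's
Lemma 4.6 for Kolyvagin classes one level apart, `torsionH1OfDvd_kolyvaginClass_pow`, margin one) and `c_n` is Selmer at the places over `v`
(Gross 6.2), then **`u_d` is Selmer at `v`** — at a transposition prime `q ∣ d_K` too: the ℚ-descended margin-one Kolyvagin class of sign `+`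
is Selmer at `q` (memo §8). [cite: McCallumLMS1991, §4 Lemma 4.3 and Lemma 4.6] [cite: Kolyvagin1989Izv, §3] [cite: GrossLMS1991, Prop. 6.2] -/
theorem mem_selmerLocalKer_of_resTorsion_level (h2 : Module.finrank ℚ K = 2) {d n : ℤ} (hdn : d ∣ n)
    (hinj : Function.Injective (resTorsion W K n))
    {ud : galH1Torsion W d} {un : galH1Torsion W n} {cd : galH1Torsion (W.baseChange K) d} {cn : galH1Torsion (W.baseChange K) n}
    (hud : resTorsion W K d ud = cd) (hun : resTorsion W K n un = cn) (hlev : torsionH1OfDvd (W.baseChange K) hdn cd = (2 : ℤ) • cn)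
    (v : HeightOneSpectrum (𝓞 ℚ))
    (hK : ∀ (w : HeightOneSpectrum (𝓞 K)) [w.asIdeal.LiesOver v.asIdeal], cn ∈ selmerLocalKer (W.baseChange K) (w.adicCompletion K) n) :
    ud ∈ selmerLocalKer W (v.adicCompletion ℚ) d := by
  have hι : torsionH1OfDvd W hdn ud = (2 : ℤ) • un :=
    hinj (by rw [resTorsion_torsionH1OfDvd, hud, hlev, map_zsmul, hun])
  exact mem_selmerLocalKer_of_torsionH1OfDvd_eq_two_zsmul_of_K W h2 hdn hι hun v hK

/-- **TQ-DEEP, member `E`, global** on `Δ(E) < 0`: same, with `c_n ∈ Sel^{(n)}(E_K/K)` ⟹ `u_d ∈ Sel^{(d)}(E/ℚ)`.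
[cite: McCallumLMS1991, §4 Lemma 4.3 and Lemma 4.6] [cite: GrossLMS1991, Prop. 6.2] -/
theorem mem_selmerGroup_of_resTorsion_level [W.IsElliptic] (h2 : Module.finrank ℚ K = 2) (hΔ : W.Δ < 0) {d n : ℤ} (hdn : d ∣ n)
    (hinj : Function.Injective (resTorsion W K n))
    {ud : galH1Torsion W d} {un : galH1Torsion W n} {cd : galH1Torsion (W.baseChange K) d} {cn : galH1Torsion (W.baseChange K) n}
    (hud : resTorsion W K d ud = cd) (hun : resTorsion W K n un = cn) (hlev : torsionH1OfDvd (W.baseChange K) hdn cd = (2 : ℤ) • cn)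
    (hsel : cn ∈ selmerGroup (W.baseChange K) n) :
    ud ∈ selmerGroup W d := by
  have hι : torsionH1OfDvd W hdn ud = (2 : ℤ) • un :=
    hinj (by rw [resTorsion_torsionH1OfDvd, hud, hlev, map_zsmul, hun])
  exact mem_selmerGroup_of_torsionH1OfDvd_eq_two_zsmul W h2 hΔ hdn hι (hun ▸ hsel)

/-- **TQ-DEEP, twin member `E^{(c)}` (displayed form)** (`K = ℚ(θ)`, `θ² = c`): `hPsiKT (res y_d) = c_d`, `hPsiKT (res y_n) = c_n`, `ι_* c_d = 2 • c_n`,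
`hPsiKT ∘ res` injective at level `n` (`EigenClassesFinite.resTorsion_twist_injective_of_noTorsion`), `c_n` Selmer at the places over `v` ⟹
**`y_d` is Selmer at `v`** — the sign-`−` Kolyvagin classes descend to the twin, ADDITIVE at the transposition primes, and are Selmer there one
level down all the same. [cite: McCallumLMS1991, §4 Lemma 4.3 and Lemma 4.6] [cite: Kolyvagin1989Izv, §3] [cite: GrossLMS1991, Prop. 6.2] -/
theorem mem_selmerLocalKer_twin_of_resTorsion_level (h2 : Module.finrank ℚ K = 2) {θ : K} {c : ℚ}
    (hθ : θ ∉ Set.range (algebraMap ℚ K)) (hc : θ ^ 2 = algebraMap ℚ K c) {d n : ℤ} (hdn : d ∣ n)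
    (hinj : Function.Injective (resTorsion (W.quadraticTwist c) K n))
    {yd : galH1Torsion (W.quadraticTwist c) d} {yn : galH1Torsion (W.quadraticTwist c) n}
    {cd : galH1Torsion (W.baseChange K) d} {cn : galH1Torsion (W.baseChange K) n}
    (hyd : hPsiKT W K hθ hc d (resTorsion (W.quadraticTwist c) K d yd) = cd)
    (hyn : hPsiKT W K hθ hc n (resTorsion (W.quadraticTwist c) K n yn) = cn)
    (hlev : torsionH1OfDvd (W.baseChange K) hdn cd = (2 : ℤ) • cn)
    (v : HeightOneSpectrum (𝓞 ℚ))
    (hK : ∀ (w : HeightOneSpectrum (𝓞 K)) [w.asIdeal.LiesOver v.asIdeal], cn ∈ selmerLocalKer (W.baseChange K) (w.adicCompletion K) n) :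
    yd ∈ selmerLocalKer (W.quadraticTwist c) (v.adicCompletion ℚ) d := by
  have hι : torsionH1OfDvd (W.quadraticTwist c) hdn yd = (2 : ℤ) • yn := by
    apply hinj
    apply (hPsiKT W K hθ hc n).injective
    rw [resTorsion_torsionH1OfDvd, hPsiKT_torsionH1OfDvd, hyd, hlev, map_zsmul, map_zsmul, hyn]
  exact mem_selmerLocalKer_twin_of_torsionH1OfDvd_eq_two_zsmul_of_K W h2 hθ hc hdn hι hyn v hK

/-- **TQ-DEEP, twin member, global** on `Δ(E) < 0` (`c ≠ 0`): `c_n ∈ Sel^{(n)}(E_K/K) ⟹ y_d ∈ Sel^{(d)}(E^{(c)}/ℚ)`.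
[cite: McCallumLMS1991, §4 Lemma 4.3 and Lemma 4.6] [cite: GrossLMS1991, Prop. 6.2] -/
theorem mem_selmerGroup_twin_of_resTorsion_level [W.IsElliptic] (h2 : Module.finrank ℚ K = 2) {θ : K} {c : ℚ}
    (hθ : θ ∉ Set.range (algebraMap ℚ K)) (hc : θ ^ 2 = algebraMap ℚ K c) (hc0 : c ≠ 0) (hΔ : W.Δ < 0) {d n : ℤ} (hdn : d ∣ n)
    (hinj : Function.Injective (resTorsion (W.quadraticTwist c) K n))
    {yd : galH1Torsion (W.quadraticTwist c) d} {yn : galH1Torsion (W.quadraticTwist c) n}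
    {cd : galH1Torsion (W.baseChange K) d} {cn : galH1Torsion (W.baseChange K) n}
    (hyd : hPsiKT W K hθ hc d (resTorsion (W.quadraticTwist c) K d yd) = cd)
    (hyn : hPsiKT W K hθ hc n (resTorsion (W.quadraticTwist c) K n yn) = cn)
    (hlev : torsionH1OfDvd (W.baseChange K) hdn cd = (2 : ℤ) • cn)
    (hsel : cn ∈ selmerGroup (W.baseChange K) n) :
    yd ∈ selmerGroup (W.quadraticTwist c) d := by
  have hι : torsionH1OfDvd (W.quadraticTwist c) hdn yd = (2 : ℤ) • yn := by
    apply hinj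
    apply (hPsiKT W K hθ hc n).injective
    rw [resTorsion_torsionH1OfDvd, hPsiKT_torsionH1OfDvd, hyd, hlev, map_zsmul, map_zsmul, hyn]
  exact mem_selmerGroup_twin_of_torsionH1OfDvd_eq_two_zsmul W h2 hθ hc hc0 hΔ hdn hι (hyn ▸ hsel)

end Rat

end Summit.BirchSwinnertonDyer.BirchSwinnertonDyer.Theorems.GenusExact.SelmerDescent

end
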